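import Summits.Ventures.HodgeRepro.Night3ExtTop

/-!
# Graded commutativity of the exterior algebra and the symmetry of the form `(x, y) ↦ ∫ x ∧ y ∧ Λ`

Blind re-derivation cell `pub-hodge-repro`, seat `night-3` (gen 6, row A; NIGHT3.md §13.1–§13.2).  Imports gen 5's
`Night3ExtTop` (the form `wedgeForm b n k Λ hΛ hN : BilinForm R (⋀^n M)`, `(x, y) ↦ ∫ x ∧ y ∧ Λ`, and
`ι_mul_ι_eq_neg`).  Namespace `HodgeRepro.Night3.ExtTop`.

* `ι_mul_comm_of_mem`: for `v : M` and `y ∈ ⋀^k M`, `ι v * y = (−1)^k • (y * ι v)` (induction on `y ∈ (range ι)^k`);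
* **`mul_comm_of_mem`** (graded commutativity): for `x ∈ ⋀^n M`, `y ∈ ⋀^k M`, `x * y = (−1)^{nk} • (y * x)`;
* `mul_comm_of_mem_even`: for `nk` even the two products are equal;
* `wedgeForm_comm`: `∫ x ∧ y ∧ Λ = (−1)^{n·n} · ∫ y ∧ x ∧ Λ` for `x, y ∈ ⋀^n M`;
* **`wedgeForm_isSymm_of_even`**: for `n` even the form `(x, y) ↦ ∫ x ∧ y ∧ Λ` is SYMMETRIC (`IsSymm`);
* `wedgeForm_eq_neg_of_odd` / **`wedgeForm_isAlt_of_odd`**: for `n` odd it is alternating (no `ℕ`-torsion in `R`).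

Nothing here is about Hodge theory; nothing here says anything about the status of the Hodge conjecture for CM
abelian varieties, which is NOT proved.
-/

set_option autoImplicit false

open Module Finset Function

namespace HodgeRepro.Night3.ExtTop

open ExteriorAlgebra

section GradedComm

variable {R : Type*} [CommRing R] {M : Type*} [AddCommGroup M] [Module R M]

/-- **A generator anticommutes `k` times past a `k`-form**: `ι v * y = (−1)^k • (y * ι v)` for `y ∈ ⋀^k M`. -/
theorem ι_mul_comm_of_mem (v : M) {k : ℕ} {y : ExteriorAlgebra R M} (hy : y ∈ ⋀[R]^k M) :
    ι R v * y = (-1 : R) ^ k • (y * ι R v) := by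
  refine Submodule.pow_induction_on_left' (LinearMap.range (ι R : M →ₗ[R] ExteriorAlgebra R M))
    (C := fun k y _ => ι R v * y = (-1 : R) ^ k • (y * ι R v)) ?_ ?_ ?_ hy
  · intro r
    rw [pow_zero, one_smul, Algebra.commutes]
  · intro x y i _ _ hx hy
    rw [mul_add, add_mul, smul_add, hx, hy]
  · rintro _ ⟨w, rfl⟩ i y _ hy
    rw [← mul_assoc, ι_mul_ι_eq_neg v w, neg_mul, mul_assoc, hy, mul_smul_comm, ← mul_assoc, pow_succ,
      mul_neg_one, neg_smul]

/-- **Graded commutativity**: for `x ∈ ⋀^n M` and `y ∈ ⋀^k M`, `x * y = (−1)^{nk} • (y * x)`. -/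
theorem mul_comm_of_mem {n k : ℕ} {x y : ExteriorAlgebra R M} (hx : x ∈ ⋀[R]^n M) (hy : y ∈ ⋀[R]^k M) :
    x * y = (-1 : R) ^ (n * k) • (y * x) := by
  refine Submodule.pow_induction_on_left' (LinearMap.range (ι R : M →ₗ[R] ExteriorAlgebra R M))
    (C := fun n x _ => x * y = (-1 : R) ^ (n * k) • (y * x)) ?_ ?_ ?_ hx
  · intro r
    rw [Nat.zero_mul, pow_zero, one_smul, Algebra.commutes]
  · intro x₁ x₂ i _ _ h₁ h₂
    rw [add_mul, mul_add, smul_add, h₁, h₂]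
  · rintro _ ⟨w, rfl⟩ i x _ hx
    rw [mul_assoc, hx, mul_smul_comm, ← mul_assoc, ι_mul_comm_of_mem w hy, smul_mul_assoc, smul_smul,
      mul_assoc, Nat.succ_mul, pow_add]

/-- For `nk` even, `x ∈ ⋀^n M` and `y ∈ ⋀^k M` commute. -/
theorem mul_comm_of_mem_even {n k : ℕ} {x y : ExteriorAlgebra R M} (hx : x ∈ ⋀[R]^n M) (hy : y ∈ ⋀[R]^k M)
    (h : Even (n * k)) : x * y = y * x := by
  rw [mul_comm_of_mem hx hy, h.neg_one_pow, one_smul]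

end GradedComm

section Form

variable {R : Type*} [CommRing R] {M : Type*} [AddCommGroup M] [Module R M]
variable {I : Type*} [LinearOrder I] [Fintype I] (b : Basis I R M)

/-- **The form `(x, y) ↦ ∫ x ∧ y ∧ Λ` is symmetric up to the sign `(−1)^{n·n}`.** -/
theorem wedgeForm_comm (n k : ℕ) (Λ : ExteriorAlgebra R M) (hΛ : Λ ∈ ⋀[R]^k M)
    (hN : Fintype.card I = n + n + k) (x y : ⋀[R]^n M) :
    wedgeForm b n k Λ hΛ hN x y = (-1 : R) ^ (n * n) * wedgeForm b n k Λ hΛ hN y x := by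
  have h : (⟨(x : ExteriorAlgebra R M) * y * Λ, mul_mul_mem x y hΛ⟩ : ⋀[R]^(n + n + k) M) =
      (-1 : R) ^ (n * n) • ⟨(y : ExteriorAlgebra R M) * x * Λ, mul_mul_mem y x hΛ⟩ := by
    ext
    simp only [Submodule.coe_smul]
    rw [mul_comm_of_mem x.2 y.2, smul_mul_assoc]
  rw [wedgeForm_apply, wedgeForm_apply, h, map_smul, smul_eq_mul]

/-- **For `n` even the form `(x, y) ↦ ∫ x ∧ y ∧ Λ` on `⋀^n M` is symmetric.** -/
theorem wedgeForm_isSymm_of_even (n k : ℕ) (Λ : ExteriorAlgebra R M) (hΛ : Λ ∈ ⋀[R]^k M)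
    (hN : Fintype.card I = n + n + k) (hn : Even n) : (wedgeForm b n k Λ hΛ hN).IsSymm := by
  refine ⟨fun x y => ?_⟩
  rw [wedgeForm_comm b n k Λ hΛ hN x y, (hn.mul_left n).neg_one_pow, one_mul]

/-- For `n` odd, `∫ x ∧ y ∧ Λ = −∫ y ∧ x ∧ Λ`. -/
theorem wedgeForm_eq_neg_of_odd (n k : ℕ) (Λ : ExteriorAlgebra R M) (hΛ : Λ ∈ ⋀[R]^k M)
    (hN : Fintype.card I = n + n + k) (hn : Odd n) (x y : ⋀[R]^n M) :
    wedgeForm b n k Λ hΛ hN x y = -wedgeForm b n k Λ hΛ hN y x := by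
  rw [wedgeForm_comm b n k Λ hΛ hN x y, (hn.mul hn).neg_one_pow, neg_one_mul]

/-- **For `n` odd the form is alternating** (no `ℕ`-torsion in `R`: `a = −a ⟹ a = 0`). -/
theorem wedgeForm_isAlt_of_odd [NoZeroSMulDivisors ℕ R] (n k : ℕ) (Λ : ExteriorAlgebra R M)
    (hΛ : Λ ∈ ⋀[R]^k M) (hN : Fintype.card I = n + n + k) (hn : Odd n) :
    (wedgeForm b n k Λ hΛ hN).IsAlt := by
  intro x
  have h := wedgeForm_eq_neg_of_odd b n k Λ hΛ hN hn x x
  rw [eq_neg_iff_add_eq_zero, ← two_nsmul] at h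
  exact (smul_eq_zero.mp h).resolve_left two_ne_zero

end Form

end HodgeRepro.Night3.ExtTop
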